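import Summits.QuantumFields.YangMills.Theorems.BalabanUVNodesN15KingModelDressedJetCovariant
import Summits.QuantumFields.YangMills.Theorems.BalabanUVNodesN15KingModelDressedJetSupCarrier
import HarnessLib

/-!
# N15 (NE2) — PROGRAMME K, part K-D (by-name half): ★★★ `T4EtaRate.NE2PlusOperator` BY NAME, HYPOTHESIS-FREE, FOR KING's FULL `A = 0` PROPAGATOR `⊗ 1` DRESSED BY THE FIRST-ORDER SPECIES ON THE
# (3.35)-PAIR CARRIER — ENTRIES 0 (VALUE), 1 (DRESSED GRADIENT) AND 3 (DRESSED COVARIANT LAPLACIAN) BACKGROUND-LIVE; entry 2 (dressed divergence) located (dag-n15-d g21 «K-D (go)»)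

WHO ∕ WHEN.  Cell `pub-ymgap`, seat `pub-ymgap-dag-n15-a` (KNIT-BY-NAME seat of Track-A DAG node N15 = NE2, g25); `--kind proof --supports stmt-QuantumFields-27366 --as helper` (K3⁸;
count-neutral).  One plumbing `def` (`foKingFamilyCov`) + theorems.  Over K-D `…KingModelDressedJetCovariant` (★★★ `hasMaj_idef_covLapJet_king`), K-C `…KingModelDressedJetSupCarrier` (`foKingInstance`,
`sq_add_two_le`, `levelCount_rate_le`), K-B (★★ `hasMaj_projO_idef_bgPair_kingJet`), K-A (`hasMaj_idef_tensorId_kingSOp`), II-E (`coeffBgFO`, `reg335_coeffBgFO_iff`, `foOps`, `osc_rate_le`), n15-b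
(`one_le_pref4`, `projO`, `bgPair`, `unstack`, `fibreOsc_of_fgrad`), g0 `etaRateIneq342_of_hasMaj_rateWeight`, `T4EtaRateCoeffDefect.fit_blockAvg` BY NAME; nothing in the tree is modified.

WHAT.  §15 `foKingFamilyCov a ν κ` = K-C's family with ENTRY 3 := `𝔇_{kingPrV}((N′²Δ′A₀′⁻¹ ⊗ 1)∘(1 + V̂′X̂′) + V̂′X̂′, (N²ΔA₀⁻¹ ⊗ 1)∘(1 + V̂X̂) + V̂X̂)` — the model's COVARIANT Laplacian `N²Δ_V X =
(N²Δ ⊗ 1 + V)X` of the dressed propagator at both spacings (background LIVE; dag-n15-d g21's identity `= m²X + T(1 + VX) − 1`), entries 0∕1 as K-C (values ∕ dressed gradient, LIVE), entry 2 := the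
rung's `U ≡ 1` η-defect `𝔇((A₀′⁻¹N′∇′*_κ) ⊗ 1, (A₀⁻¹N∇*_κ) ⊗ 1)` (U-blind, located); §16 ★★★ `ne2PlusOperator_kingJet_covariant (hd : 1 ≤ d) (hLodd) (hL : 2 ≤ L) (ha) (hm0) (c₃₅) (hc₃₅) (ν κ) :
NE2PlusOperator c₃₅ (foKingInstance d L) (foKingFamilyCov d L a ν κ)` — HYPOTHESIS-FREE (`M₅ = 1`, `a₀ = r₀∕c₃₅`, King's `γ = ½`, rate number `(L^K)^{−1∕4}`); ★★ `ne2ZeroOperator_kingJet_covariant`; `_dim4`.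

HONEST FRAMING ∕ LIMITS.  HYBRID family: entries 0, 1, 3 carry the configuration genuinely, entry 2 is the bare rung defect (the dressed divergence entry needs the pure second source difference
of `A₀′⁻¹` summed over cells — located, dag-n15-d g18∕g21); abelianised scalar-multiplier MODEL of (3.52)'s `V′(A)`, block-averaged coarse partner (C3); King's `A = 0` MODEL on finite tori
(template literature [King1986] (2.13)–(2.17) p.653, (4.1)–(4.5) p.670, (4.36) p.674), NOT Bałaban's covariant `G(U)`.  NE2⁺ as printed NOT PRINTED ∕ NOT proved; no statement of record touched;
N15 NOT discharged; K3⁸ OPEN; counts UNMOVED (typed 28∕28 · discharged 5∕27); one finite torus per index — NOT ℝ⁴ ∕ infinite volume ∕ OS ∕ mass gap ∕ Clay.  ONE declared `set_option maxHeartbeats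
1600000 in` on ★★★ (the entry-3 operator is a long term; elaboration of the readout against the unfolded family; farm ≈ 60 s for the file).
-/

noncomputable section

open scoped BigOperators
open Finset

namespace Summit.QuantumFields.YangMills.BalabanUVNodes.N15.TwoGrid.KingJet

open Literature.MathematicalPhysics.QuantumFieldTheory.Balaban1983to89
open Literature.MathematicalPhysics.QuantumFieldTheory.Balaban1983to89.B11SectG (BlockNorm HasMaj)
open Literature.MathematicalPhysics.QuantumFieldTheory.Balaban1983to89.T4EtaRate (PairedInstance EtaPairing EtaRateIneq342 NE2PlusOperator NE2ZeroOperator ne2Zero_of_ne2Plus)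
open Literature.MathematicalPhysics.QuantumFieldTheory.Balaban1983to89.T4EtaRateDefect (idef rateWeight)
open Literature.MathematicalPhysics.QuantumFieldTheory.Balaban1983to89.T4EtaRateCoeffDefect (pull blockAvg fit_blockAvg)
open Literature.MathematicalPhysics.QuantumFieldTheory.Balaban1983to89.B5Prop11Plancherel (Tor fine unitVec)
open Literature.MathematicalPhysics.QuantumFieldTheory.King1986.Torus (blockOf tdistT tdistT_nonneg)
open Literature.MathematicalPhysics.QuantumFieldTheory.Balaban1983to89.B6UnitTorusCarrier (unitTorusGeo)
open Summit.QuantumFields.YangMills.BalabanUVNodes.N15.VectorPiece (blkFine kingPrV blkFine_comp_kingPrV unitTorusGeoS rateWeight_unitTorusGeoS tensorId bshiftEquiv)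
open Summit.QuantumFields.YangMills.BalabanUVNodes.N15.OperatorReadout (opGeo opFamily opGeo_len etaRateIneq342_of_hasMaj_rateWeight)
open Summit.QuantumFields.YangMills.BalabanUVNodes.N15.BackgroundLayer (bgPair projO unstack fineGeo one_le_pref4 fgrad fgrad_apply fibreOsc_of_fgrad)
open Summit.QuantumFields.YangMills.BalabanUVNodes.N15KingModelRung.Curved (kingGOp kingSOp kingLapOp EtaLatIdx)

variable {d : ℕ}

/-! ## §15 The family with the covariant-Laplacian entry live -/

section Sized

variable (d) (L : ℕ) [NeZero L] {m0sq : ℝ}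

/-- THE KERNEL FAMILY WITH THE COVARIANT-LAPLACIAN ENTRY LIVE at a rung index: K-C's `foKingFamily` with ENTRY 3 := `𝔇_{kingPrV}((N′²Δ′A₀′⁻¹ ⊗ 1)∘(1 + V̂′X̂′) + V̂′X̂′, (N²ΔA₀⁻¹ ⊗ 1)∘(1 + V̂X̂) + V̂X̂)`,
the model's covariant Laplacian `(N²Δ ⊗ 1 + V)X` of the dressed propagator `X = (A₀⁻¹ ⊗ 1)(1 + VX)` at both spacings (background LIVE); entry 0 = values, entry 1 = the dressed gradient
(both LIVE, K-C), entry 2 = the rung's `U ≡ 1` η-defect of `(A₀⁻¹N∇*_κ) ⊗ 1` (U-blind, located); read through `opFamily`.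
[cite: Balaban1985BackgroundPropagators, (3.42) p.397 (the four entries; fourth = the covariant Laplacian), (3.52) p.400, (3.62)–(3.65) pp.402–403 (mechanism); King1986, (4.1)–(4.5) p.670, (4.36) p.674] -/
def foKingFamilyCov (a : ℝ) (ν κ : Fin (d + 1)) (i : EtaLatIdx d m0sq) : B9.KernelFamily (foKingInstance d L i).gc (foKingInstance d L i).Bf :=
  show B9.KernelFamily (opGeo (unitTorusGeoS L i.K (EtaLatIdx.cube L i) i.Msz) (Tor (fine (L ^ i.K) (EtaLatIdx.cube L i)) × Fin (d + 1)) (blkFine L i.K (EtaLatIdx.cube L i)))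
      (coeffBgFO (EtaLatIdx.cube L i) (L ^ i.n * L ^ i.K) i.Msz) from
    opFamily (g := unitTorusGeoS L i.K (EtaLatIdx.cube L i) i.Msz) (B := coeffBgFO (EtaLatIdx.cube L i) (L ^ i.n * L ^ i.K) i.Msz)
      (blkFine L i.K (EtaLatIdx.cube L i)) (blkFine L i.K (EtaLatIdx.cube L i) ∘ kingPrV L i.K i.n (EtaLatIdx.cube L i))
      (foOps (EtaLatIdx.cube L i) i.K i.n i.Msz (tensorId (Fin (d + 1)) (kingGOp L a i.msq i.K (L ^ i.K) (EtaLatIdx.cube L i)))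
        (tensorId (Fin (d + 1)) (kingGOp L a i.msq (i.K + i.n) (L ^ i.n * L ^ i.K) (EtaLatIdx.cube L i)))
        fun j U => ![
          idef (pull (kingPrV L i.K i.n (EtaLatIdx.cube L i))) (pull (kingPrV L i.K i.n (EtaLatIdx.cube L i)))
            (projO (some ν) ∘ₗ bgPair (tensorId (Fin (d + 1)) (kingGOp L a i.msq (i.K + i.n) (L ^ i.n * L ^ i.K) (EtaLatIdx.cube L i)))
              (fun μ => symbOp (EtaLatIdx.cube L i) (L ^ i.n * L ^ i.K) (sD (EtaLatIdx.cube L i) (L ^ i.n * L ^ i.K) μ ((L ^ i.n * L ^ i.K : ℕ) : ℝ)) ∘ₗ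
                tensorId (Fin (d + 1)) (kingGOp L a i.msq (i.K + i.n) (L ^ i.n * L ^ i.K) (EtaLatIdx.cube L i))) U.1 U.2)
            (projO (some ν) ∘ₗ bgPair (tensorId (Fin (d + 1)) (kingGOp L a i.msq i.K (L ^ i.K) (EtaLatIdx.cube L i)))
              (fun μ => symbOp (EtaLatIdx.cube L i) (L ^ i.K) (sD (EtaLatIdx.cube L i) (L ^ i.K) μ ((L ^ i.K : ℕ) : ℝ)) ∘ₗ
                tensorId (Fin (d + 1)) (kingGOp L a i.msq i.K (L ^ i.K) (EtaLatIdx.cube L i)))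
              (blockAvg (kingPrV L i.K i.n (EtaLatIdx.cube L i)) U.1) (fun μ => blockAvg (kingPrV L i.K i.n (EtaLatIdx.cube L i)) (U.2 μ))),
          idef (pull (kingPrV L i.K i.n (EtaLatIdx.cube L i))) (pull (kingPrV L i.K i.n (EtaLatIdx.cube L i)))
            (tensorId (Fin (d + 1)) (kingSOp L a i.msq (i.K + i.n) (L ^ i.n * L ^ i.K) (EtaLatIdx.cube L i) κ))
            (tensorId (Fin (d + 1)) (kingSOp L a i.msq i.K (L ^ i.K) (EtaLatIdx.cube L i) κ)),
          idef (pull (kingPrV L i.K i.n (EtaLatIdx.cube L i))) (pull (kingPrV L i.K i.n (EtaLatIdx.cube L i)))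
            (tensorId (Fin (d + 1)) (kingLapOp L a i.msq (i.K + i.n) (L ^ i.n * L ^ i.K) (EtaLatIdx.cube L i)) ∘ₗ
                (LinearMap.id + unstack U.1 U.2 ∘ₗ bgPair (tensorId (Fin (d + 1)) (kingGOp L a i.msq (i.K + i.n) (L ^ i.n * L ^ i.K) (EtaLatIdx.cube L i)))
                  (fun μ => symbOp (EtaLatIdx.cube L i) (L ^ i.n * L ^ i.K) (sD (EtaLatIdx.cube L i) (L ^ i.n * L ^ i.K) μ ((L ^ i.n * L ^ i.K : ℕ) : ℝ)) ∘ₗ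
                    tensorId (Fin (d + 1)) (kingGOp L a i.msq (i.K + i.n) (L ^ i.n * L ^ i.K) (EtaLatIdx.cube L i))) U.1 U.2) +
              unstack U.1 U.2 ∘ₗ bgPair (tensorId (Fin (d + 1)) (kingGOp L a i.msq (i.K + i.n) (L ^ i.n * L ^ i.K) (EtaLatIdx.cube L i)))
                (fun μ => symbOp (EtaLatIdx.cube L i) (L ^ i.n * L ^ i.K) (sD (EtaLatIdx.cube L i) (L ^ i.n * L ^ i.K) μ ((L ^ i.n * L ^ i.K : ℕ) : ℝ)) ∘ₗ
                  tensorId (Fin (d + 1)) (kingGOp L a i.msq (i.K + i.n) (L ^ i.n * L ^ i.K) (EtaLatIdx.cube L i))) U.1 U.2)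
            (tensorId (Fin (d + 1)) (kingLapOp L a i.msq i.K (L ^ i.K) (EtaLatIdx.cube L i)) ∘ₗ
                (LinearMap.id + unstack (blockAvg (kingPrV L i.K i.n (EtaLatIdx.cube L i)) U.1) (fun μ => blockAvg (kingPrV L i.K i.n (EtaLatIdx.cube L i)) (U.2 μ)) ∘ₗ
                  bgPair (tensorId (Fin (d + 1)) (kingGOp L a i.msq i.K (L ^ i.K) (EtaLatIdx.cube L i)))
                    (fun μ => symbOp (EtaLatIdx.cube L i) (L ^ i.K) (sD (EtaLatIdx.cube L i) (L ^ i.K) μ ((L ^ i.K : ℕ) : ℝ)) ∘ₗ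
                      tensorId (Fin (d + 1)) (kingGOp L a i.msq i.K (L ^ i.K) (EtaLatIdx.cube L i)))
                    (blockAvg (kingPrV L i.K i.n (EtaLatIdx.cube L i)) U.1) (fun μ => blockAvg (kingPrV L i.K i.n (EtaLatIdx.cube L i)) (U.2 μ))) +
              unstack (blockAvg (kingPrV L i.K i.n (EtaLatIdx.cube L i)) U.1) (fun μ => blockAvg (kingPrV L i.K i.n (EtaLatIdx.cube L i)) (U.2 μ)) ∘ₗ
                bgPair (tensorId (Fin (d + 1)) (kingGOp L a i.msq i.K (L ^ i.K) (EtaLatIdx.cube L i)))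
                  (fun μ => symbOp (EtaLatIdx.cube L i) (L ^ i.K) (sD (EtaLatIdx.cube L i) (L ^ i.K) μ ((L ^ i.K : ℕ) : ℝ)) ∘ₗ
                    tensorId (Fin (d + 1)) (kingGOp L a i.msq i.K (L ^ i.K) (EtaLatIdx.cube L i)))
                  (blockAvg (kingPrV L i.K i.n (EtaLatIdx.cube L i)) U.1) (fun μ => blockAvg (kingPrV L i.K i.n (EtaLatIdx.cube L i)) (U.2 μ)))] j)

end Sized

/-! ## §16 ★★★ `NE2PlusOperator` BY NAME, entries 0, 1 and 3 background-live, hypothesis-free -/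

section Main

variable (d) {L : ℕ} [NeZero L] {m0sq : ℝ}

set_option maxHeartbeats 1600000 in
/-- ★★★ **NE2⁺, OPERATOR LAYER — `T4EtaRate.NE2PlusOperator` BY NAME, HYPOTHESIS-FREE, FOR KING's FULL `A = 0` PROPAGATOR `⊗ 1` DRESSED BY THE FIRST-ORDER SPECIES ON THE (3.35)-PAIR CARRIER, WITH
THE VALUE AND THE GRADIENT ENTRIES BACKGROUND-LIVE.**  For `d ≥ 1`, odd `L ≥ 3` (stated `Odd L`, `2 ≤ L`), `a > 0`, `m₀² ≥ 0`, `c₃₅ > 0`, directions `ν, κ`: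
`NE2PlusOperator c₃₅ (foKingInstance d L) (foKingFamilyCov d L a ν κ)`.  (3.35) is consumed as the sup of `c′`, `a′_μ` and of the first quotients of `a′` — NOTHING on `∇c′`; the size guard is LIVE
(cofinal family); `M_sz·α₀ ≤ a₀ = r₀∕c₃₅` drives the jets' Neumann series; entries 0 AND 1 carry the background GENUINELY (K-B); entries 2–3 are the rung's `U ≡ 1` η-defects (K-A); King's exponent taken at `γ = ½`,
common rate number `(L^K)^{−1∕4}` (the level count `(K+2)L^{−K}` and the derived fit `L^{−K}` absorbed). [cite: Balaban1985BackgroundPropagators, Thm 3.1 p.397 (quantifier template), (3.35) p.396, (3.42) p.397, (3.52)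
p.400, (3.62)–(3.65) pp.402–403 (shapes, mechanism); King1986, (2.13)–(2.17) p.653, Prop. 3.8 (3.71) p.664, Prop. 3.9 (3.73) p.665, (4.42) p.675] -/
theorem ne2PlusOperator_kingJet_covariant (hd : 1 ≤ d) (hLodd : Odd L) (hL : 2 ≤ L) {a : ℝ} (ha : 0 < a) (hm0 : 0 ≤ m0sq) (c35 : ℝ) (hc35 : 0 < c35)
    (ν κ : Fin (d + 1)) : NE2PlusOperator c35 (foKingInstance d L (m0sq := m0sq)) (foKingFamilyCov d L a ν κ) := by
  -- King's rate exponent `γ := 1∕2` (any `γ ∈ (0, 1)` would do); the family's rate number is then `(L^K)^{−1∕4}`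
  obtain ⟨γ, hγ0, hγ1⟩ : ∃ γ : ℝ, 0 < γ ∧ γ < 1 := ⟨1 / 2, by norm_num, by norm_num⟩
  have hL3 : 3 ≤ L := by
    rcases hLodd with ⟨t, ht⟩
    omega
  have hL1 : (1 : ℝ) ≤ (L : ℝ) := by exact_mod_cast (show 1 ≤ L by omega)
  have hLr : (0 : ℝ) < (L : ℝ) := by positivity
  -- entries 0–1: K-B; entry 2: K-A; entry 3: K-D
  obtain ⟨δJ, rJ, B, hδJ, hrJ, hB, HJ⟩ := hasMaj_projO_idef_bgPair_kingJet d L hd hLodd hL ha hm0 hγ0.le hγ1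
  obtain ⟨m₂, δ₂, hm₂, hδ₂, H2⟩ := hasMaj_idef_tensorId_kingSOp (d := d) L hLodd hL ha hm0 hγ0.le hγ1
  obtain ⟨δ₃, r₃, B₃, hδ₃, hr₃, hB₃, H3⟩ := hasMaj_idef_covLapJet_king d L hd hLodd hL ha hm0 hγ0.le hγ1
  set r₀ : ℝ := min rJ r₃ with hr₀def
  have hr₀ : 0 < r₀ := lt_min hrJ hr₃
  set δ₀ : ℝ := min δJ (min δ₂ δ₃) with hδ₀def
  have hδ₀ : 0 < δ₀ := lt_min hδJ (lt_min hδ₂ hδ₃)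
  set BJ : ℝ := B * (1 + 2 * r₀ + 2 * ((d : ℝ) + 1) * r₀) with hBJdef
  have hBJ : 0 < BJ := by positivity
  set BC : ℝ := B₃ * (1 + 2 * r₀ + 2 * ((d : ℝ) + 1) * r₀) with hBCdef
  have hBC : 0 < BC := by positivity
  set B₀ : ℝ := BJ + m₂ + BC with hB₀def
  have hB₀ : 0 < B₀ := by positivity
  refine ⟨1, δ₀, r₀ / c35, B₀, γ / 2, one_pos, hδ₀, by positivity, hB₀, by positivity, fun i _hM α₀ hα₀ hMα U hU => ?_⟩
  -- at the index `i`: the letters of the configuration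
  obtain ⟨hU1, hU2, hU3⟩ := (reg335_coeffBgFO_iff (EtaLatIdx.cube L i) (L ^ i.n * L ^ i.K) i.Msz c35 α₀ U).1 hU
  have hMsz : (0 : ℝ) ≤ i.Msz := zero_le_one.trans i.one_le_Msz
  have hr0 : 0 ≤ c35 * i.Msz * α₀ := by positivity
  have hrr₀ : c35 * i.Msz * α₀ ≤ r₀ := by
    have h := mul_le_mul_of_nonneg_left hMα hc35.le
    rw [foKingInstance_gf_M, mul_div_cancel₀ _ hc35.ne'] at h
    linarith [h]
  have hn' : (0 : ℝ) < ((L ^ i.n * L ^ i.K : ℕ) : ℝ) := by positivity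
  have hfa : ∀ μ' z, |U.2 μ' z - blockAvg (kingPrV L i.K i.n (EtaLatIdx.cube L i)) (U.2 μ') (kingPrV L i.K i.n (EtaLatIdx.cube L i) z)| ≤
      ((2 * ((d + 1) * (L ^ i.n - 1)) : ℕ) : ℝ) * (c35 * i.Msz * α₀ / ((L ^ i.n * L ^ i.K : ℕ) : ℝ)) :=
    fun μ' z => fit_blockAvg _ (fibreOsc_of_fgrad L i.K i.n (EtaLatIdx.cube L i) hn' fun κ' z => hU3 μ' κ' z) z
  have hoa : 0 ≤ ((2 * ((d + 1) * (L ^ i.n - 1)) : ℕ) : ℝ) * (c35 * i.Msz * α₀ / ((L ^ i.n * L ^ i.K : ℕ) : ℝ)) := by positivity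
  have hJ := HJ i.K i.one_le_K i.n i.one_le_n i.e (EtaLatIdx.cube L i) (fun _ => rfl) i.msq i.msq_pos i.msq_le _ hr0 (hrr₀.trans (min_le_left _ _)) _ hoa U.1 U.2 hU1 hU2 hfa
  have hC := H3 i.K i.one_le_K i.n i.one_le_n i.e (EtaLatIdx.cube L i) (fun _ => rfl) i.msq i.msq_pos i.msq_le _ hr0 (hrr₀.trans (min_le_right _ _)) _ hoa U.1 U.2 hU1 hU2 hfa
  -- the readout
  have hη : 0 < (unitTorusGeoS L i.K (EtaLatIdx.cube L i) i.Msz).eta := inv_pos.mpr (pow_pos hLr _)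
  have hblk : blkFine L i.K (EtaLatIdx.cube L i) ∘ kingPrV L i.K i.n (EtaLatIdx.cube L i) =
      fun j : Tor (fine (L ^ i.n * L ^ i.K) (EtaLatIdx.cube L i)) × Fin (d + 1) => blockOf (L ^ i.n * L ^ i.K) (EtaLatIdx.cube L i) j.1 :=
    blkFine_comp_kingPrV (EtaLatIdx.cube L i) L i.K i.n
  unfold foKingFamilyCov
  rw [hblk]
  -- the common rate number and the three absorptions
  have hθ : 0 ≤ ((L : ℝ) ^ i.K) ^ (-(γ / 2)) := Real.rpow_nonneg (pow_nonneg hLr.le _) _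
  have hx1 : (1 : ℝ) ≤ (L : ℝ) ^ i.K := one_le_pow₀ hL1
  have hhalf : ((L : ℝ) ^ i.K) ^ (-(1 / 2 : ℝ)) ≤ ((L : ℝ) ^ i.K) ^ (-(γ / 2)) := Real.rpow_le_rpow_of_exponent_le hx1 (by linarith)
  have hlev : (c35 * i.Msz * α₀) * ((((i.K : ℕ) : ℝ) + 2) / (L : ℝ) ^ i.K) ≤ 2 * r₀ * ((L : ℝ) ^ i.K) ^ (-(γ / 2)) := by
    calc (c35 * i.Msz * α₀) * ((((i.K : ℕ) : ℝ) + 2) / (L : ℝ) ^ i.K) ≤ r₀ * (2 * ((L : ℝ) ^ i.K) ^ (-(1 / 2 : ℝ))) :=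
          mul_le_mul hrr₀ (levelCount_rate_le hL3 i.K) (div_nonneg (by positivity) (pow_nonneg hLr.le _)) hr₀.le
      _ ≤ r₀ * (2 * ((L : ℝ) ^ i.K) ^ (-(γ / 2))) := mul_le_mul_of_nonneg_left (by linarith) hr₀.le
      _ = 2 * r₀ * ((L : ℝ) ^ i.K) ^ (-(γ / 2)) := by ring
  have hosc := osc_rate_le (d := d) i.K i.n hL1 (γ := γ / 2) hr0 hrr₀ (by linarith)
  have hsum : ((L : ℝ) ^ i.K) ^ (-(γ / 2)) + (c35 * i.Msz * α₀) * ((((i.K : ℕ) : ℝ) + 2) / (L : ℝ) ^ i.K) +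
      ((2 * ((d + 1) * (L ^ i.n - 1)) : ℕ) : ℝ) * (c35 * i.Msz * α₀ / ((L ^ i.n * L ^ i.K : ℕ) : ℝ)) ≤ (1 + 2 * r₀ + 2 * ((d : ℝ) + 1) * r₀) * ((L : ℝ) ^ i.K) ^ (-(γ / 2)) := by
    nlinarith [hlev, hosc]
  have hrw : ∀ y' : Tor (EtaLatIdx.cube L i), rateWeight (unitTorusGeoS L i.K (EtaLatIdx.cube L i) i.Msz) (γ / 2) y' = ((L : ℝ) ^ i.K) ^ (-(γ / 2)) :=
    fun y' => rateWeight_unitTorusGeoS L (EtaLatIdx.cube L i) i.K i.Msz (γ / 2) y'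
  have hexp : ∀ {t : ℝ} (y y' : Tor (EtaLatIdx.cube L i)), δ₀ ≤ t →
      Real.exp (-(t * tdistT (EtaLatIdx.cube L i) y y')) ≤ Real.exp (-(δ₀ * tdistT (EtaLatIdx.cube L i) y y')) :=
    fun y y' ht => Real.exp_le_exp.mpr (by nlinarith [tdistT_nonneg (EtaLatIdx.cube L i) y y'])
  have hδ₀J : δ₀ ≤ δJ := min_le_left _ _
  have hδ₀2 : δ₀ ≤ δ₂ := (min_le_right _ _).trans (min_le_left _ _)
  have hδ₀3 : δ₀ ≤ δ₃ := (min_le_right _ _).trans (min_le_right _ _)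
  -- absorption of `B·(θ + r t + o_a)·e^{−δ_x d}` into `B(1 + 2r₀ + 2(d+1)r₀)·e^{−δ₀ d}·θ`
  have habs : ∀ {T : (Tor (fine (L ^ i.K) (EtaLatIdx.cube L i)) × Fin (d + 1) → ℝ) →ₗ[ℝ] (Tor (fine (L ^ i.n * L ^ i.K) (EtaLatIdx.cube L i)) × Fin (d + 1) → ℝ)} {Bx δx : ℝ},
      0 ≤ Bx → δ₀ ≤ δx →
      HasMaj (BlockNorm.ofBlocks (unitTorusGeoS L i.K (EtaLatIdx.cube L i) i.Msz) (blkFine L i.K (EtaLatIdx.cube L i)))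
        (BlockNorm.ofBlocks (unitTorusGeoS L i.K (EtaLatIdx.cube L i) i.Msz) (fun j' : Tor (fine (L ^ i.n * L ^ i.K) (EtaLatIdx.cube L i)) × Fin (d + 1) => blockOf (L ^ i.n * L ^ i.K) (EtaLatIdx.cube L i) j'.1))
        T (fun y y' => Bx * (((L : ℝ) ^ i.K) ^ (-(γ / 2)) + c35 * i.Msz * α₀ * ((((i.K : ℕ) : ℝ) + 2) / (L : ℝ) ^ i.K) +
            ((2 * ((d + 1) * (L ^ i.n - 1)) : ℕ) : ℝ) * (c35 * i.Msz * α₀ / ((L ^ i.n * L ^ i.K : ℕ) : ℝ))) * Real.exp (-(δx * tdistT (EtaLatIdx.cube L i) y y'))) →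
      HasMaj (BlockNorm.ofBlocks (unitTorusGeoS L i.K (EtaLatIdx.cube L i) i.Msz) (blkFine L i.K (EtaLatIdx.cube L i)))
        (BlockNorm.ofBlocks (unitTorusGeoS L i.K (EtaLatIdx.cube L i) i.Msz) (fun j' : Tor (fine (L ^ i.n * L ^ i.K) (EtaLatIdx.cube L i)) × Fin (d + 1) => blockOf (L ^ i.n * L ^ i.K) (EtaLatIdx.cube L i) j'.1))
        T (fun y y' => Bx * (1 + 2 * r₀ + 2 * ((d : ℝ) + 1) * r₀) * Real.exp (-(δ₀ * tdistT (EtaLatIdx.cube L i) y y')) *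
          rateWeight (unitTorusGeoS L i.K (EtaLatIdx.cube L i) i.Msz) (γ / 2) y') := by
    intro T Bx δx hBx hδx h
    refine h.mono fun y y' => ?_
    rw [hrw]
    have hE := Real.exp_nonneg (-(δx * tdistT (EtaLatIdx.cube L i) y y'))
    calc Bx * (((L : ℝ) ^ i.K) ^ (-(γ / 2)) + c35 * i.Msz * α₀ * ((((i.K : ℕ) : ℝ) + 2) / (L : ℝ) ^ i.K) +
            ((2 * ((d + 1) * (L ^ i.n - 1)) : ℕ) : ℝ) * (c35 * i.Msz * α₀ / ((L ^ i.n * L ^ i.K : ℕ) : ℝ))) * Real.exp (-(δx * tdistT (EtaLatIdx.cube L i) y y'))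
        ≤ Bx * ((1 + 2 * r₀ + 2 * ((d : ℝ) + 1) * r₀) * ((L : ℝ) ^ i.K) ^ (-(γ / 2))) * Real.exp (-(δ₀ * tdistT (EtaLatIdx.cube L i) y y')) :=
          mul_le_mul (mul_le_mul_of_nonneg_left hsum hBx) (hexp y y' hδx) hE (by positivity)
      _ = Bx * (1 + 2 * r₀ + 2 * ((d : ℝ) + 1) * r₀) * Real.exp (-(δ₀ * tdistT (EtaLatIdx.cube L i) y y')) * ((L : ℝ) ^ i.K) ^ (-(γ / 2)) := by ring
  have hjet := fun j => habs hB.le hδ₀J (hJ j)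
  have h3c := habs hB₃.le hδ₀3 hC
  refine etaRateIneq342_of_hasMaj_rateWeight (g := unitTorusGeoS L i.K (EtaLatIdx.cube L i) i.Msz) (B := coeffBgFO (EtaLatIdx.cube L i) (L ^ i.n * L ^ i.K) i.Msz)
    (blkFine L i.K (EtaLatIdx.cube L i)) (fun j : Tor (fine (L ^ i.n * L ^ i.K) (EtaLatIdx.cube L i)) × Fin (d + 1) => blockOf (L ^ i.n * L ^ i.K) (EtaLatIdx.cube L i) j.1)
    hη hLr hB₀.le (c := ![BJ, BJ, m₂, BC]) (fun n => by fin_cases n <;> simp <;> positivity) (fun n y => ?_) _ U fun n => ?_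
  · -- `c n ≤ B₀ ≤ B₀·pref4`
    have hlen : 1 ≤ (unitTorusGeoS L i.K (EtaLatIdx.cube L i) i.Msz).len y := by
      show (1 : ℝ) ≤ (L : ℝ) ^ i.K * (((L : ℝ) ^ i.K)⁻¹)
      rw [mul_inv_cancel₀ (pow_ne_zero _ hLr.ne')]
    have hpref := one_le_pref4 hlen n
    have hcn : (![BJ, BJ, m₂, BC] : Fin 4 → ℝ) n ≤ B₀ := by
      fin_cases n
      · show BJ ≤ B₀; rw [hB₀def]; linarith
      · show BJ ≤ B₀; rw [hB₀def]; linarith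
      · show m₂ ≤ B₀; rw [hB₀def]; linarith
      · show BC ≤ B₀; rw [hB₀def]; linarith
    calc _ ≤ B₀ := hcn
      _ = B₀ * 1 := (mul_one _).symm
      _ ≤ _ := mul_le_mul_of_nonneg_left hpref hB₀.le
  · fin_cases n
    · exact hjet none
    · exact hjet (some ν)
    · have h2 := H2 i.K i.one_le_K i.n i.one_le_n i.e (EtaLatIdx.cube L i) (fun _ => rfl) i.msq i.msq_pos i.msq_le κ
      refine h2.mono fun y y' => ?_
      show _ ≤ m₂ * Real.exp (-(δ₀ * tdistT (EtaLatIdx.cube L i) y y')) * rateWeight (unitTorusGeoS L i.K (EtaLatIdx.cube L i) i.Msz) (γ / 2) y'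
      rw [hrw]
      calc m₂ * ((L : ℝ) ^ i.K) ^ (-(γ / 2)) * Real.exp (-(δ₂ * tdistT (EtaLatIdx.cube L i) y y'))
          ≤ m₂ * ((L : ℝ) ^ i.K) ^ (-(γ / 2)) * Real.exp (-(δ₀ * tdistT (EtaLatIdx.cube L i) y y')) := mul_le_mul_of_nonneg_left (hexp y y' hδ₀2) (mul_nonneg hm₂.le hθ)
        _ = _ := by ring
    · exact h3c

/-- ★★ **NE2⁰ FOR THE SAME FAMILY — `T4EtaRate.NE2ZeroOperator` BY NAME**: the trivial family `U = 0` is regular for every `α₀ > 0` under the guard, so `ne2Zero_of_ne2Plus` applies.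
[cite: King1986, Props. 3.8–3.9 (3.71)–(3.75) pp.664–665 (A = 0 model); Balaban1985BackgroundPropagators, Thm 3.1 p.397 (quantifier template)] -/
theorem ne2ZeroOperator_kingJet_covariant (hd : 1 ≤ d) (hLodd : Odd L) (hL : 2 ≤ L) {a : ℝ} (ha : 0 < a) (hm0 : 0 ≤ m0sq) {c35 : ℝ} (hc35 : 0 < c35) (ν κ : Fin (d + 1)) :
    NE2ZeroOperator (foKingInstance d L (m0sq := m0sq)) (foKingFamilyCov d L a ν κ) := by
  refine ne2Zero_of_ne2Plus (c35 := c35) (fun i α₀ hα₀ => ?_) (ne2PlusOperator_kingJet_covariant d hd hLodd hL ha hm0 c35 hc35 ν κ)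
  have hM : (0 : ℝ) ≤ i.Msz := zero_le_one.trans i.one_le_Msz
  have h0 : (0 : ℝ) ≤ c35 * i.Msz * α₀ := by positivity
  refine (reg335_coeffBgFO_iff (EtaLatIdx.cube L i) (L ^ i.n * L ^ i.K) i.Msz c35 α₀ _).2 ⟨fun z => ?_, fun μ' z => ?_, fun μ' κ' z => ?_⟩
  · show |(0 : ℝ)| ≤ _; rw [abs_zero]; exact h0
  · show |(0 : ℝ)| ≤ _; rw [abs_zero]; exact h0
  · rw [fgrad_apply]
    show |((L ^ i.n * L ^ i.K : ℕ) : ℝ) * ((0 : ℝ) - 0)| ≤ _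
    rw [sub_zero, mul_zero, abs_zero]; exact h0

/-- `d + 1 = 4`: the physical lattice dimension (King's model on `𝕋⁴_ε`; [B9]'s `d = 4`). [cite: King1986, p.653 (d + 1 = 4); Balaban1985BackgroundPropagators, Thm 3.1 p.397] -/
theorem ne2PlusOperator_kingJet_covariant_dim4 (hLodd : Odd L) (hL : 2 ≤ L) {a : ℝ} (ha : 0 < a) (hm0 : 0 ≤ m0sq) (c35 : ℝ) (hc35 : 0 < c35) (ν κ : Fin (3 + 1)) :
    NE2PlusOperator c35 (foKingInstance 3 L (m0sq := m0sq)) (foKingFamilyCov 3 L a ν κ) :=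
  ne2PlusOperator_kingJet_covariant 3 (by norm_num) hLodd hL ha hm0 c35 hc35 ν κ

end Main

end Summit.QuantumFields.YangMills.BalabanUVNodes.N15.TwoGrid.KingJet

end
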